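import Summits.HodgeConjecture.CorCM.MumfordTateRankRibetTypeOnePairsRigid
import Summits.HodgeConjecture.CorCM.MumfordTateRankRigidTimesNonCMCurve
import HarnessLib

/-!
# A Ribet pair times a non-CM elliptic curve: `t(A × A′ × E) = t(A × A′) + 3` (so `g² + 4 / g² + g′² + 3 / g² + g′² + 4`),
# and for `g ≠ g′` the product `(A × A′) × E` is again `Θ`-rigid

COR-CM (cell `pub-hodgecm2`, seat `b27` gen 53, count-neutral Mumford–Tate-rank ladder; theorems only, no definition, no named fact; UNCONDITIONAL —
nothing here uses or asserts HC_CM).  `t := dim MT(H¹·)`.  `A`, `A′` of Ribet types `(g−1,1)`, `(g′−1,1)` (`g, g′ ≥ 3`); `E` an elliptic curve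
WITHOUT complex multiplication.  Moonen–Zarhinʼs Lemma (3.4) for the factor `E` (`CorCM/MumfordTateRankTimesNonCMCurve`, gen 47: `t(B × E) =
t(B) + 3` for every `B` with `Hom(B, E) = 0`) and `Hom(A × A′, E) = 0` (`A`, `A′` simple of dimension `≥ 3`), combined with the complete
trichotomy for `t(A × A′)` (`CorCM/MumfordTateRankRibetTypeOnePairsSameField`):
* **`mtRank_hodge_one_eq_of_isIsogenous_ribetTypeOne_prod_prod_nonCMCurve`** — `t(X) = t(A × A′) + 3` for `X ∼ (A × A′) × E`;
  **`mtRank_hodge_one_trichotomy_of_isIsogenous_ribetTypeOne_prod_prod_nonCMCurve`** — `t(X) = g² + 4` (`A ∼ A′`) / `g² + g′² + 3`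
  (`A ≁ A′`, isomorphic fields) / `g² + g′² + 4` (non-isomorphic fields).
* **`hodgeLie_rigid_ribetTypeOne_prod_prod_nonCMCurve_of_dim_ne`** — `g ≠ g′`: `H¹((A × A′) × E)` is `Θ`-rigid (`…PairsRigid` and
  `hodgeLie_rigid_prod_nonCMCurve_of_rigid`), so **`t(((A × A′) × E) × Y) ≥ t(A × A′) + 3`** for every `Y`
  (`mtRank_hodge_one_add_three_le_of_isIsogenous_ribetTypeOne_prod_prod_nonCMCurve_prod`).

## References
* [MoonenZarhin1999LowDim] B. Moonen, Yu. G. Zarhin, *Hodge classes on abelian varieties of low dimension*, Math. Ann. 315 (1999), §3 (3.1), Lemma (3.4),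
  Prop. (3.8) [corpus: paper:arxiv-math_9901113 pp. 6–7]. [cite: MoonenZarhin1999LowDim, §3 (3.1) and Lemma (3.4)]
* [MumfordAV1970] D. Mumford, *Abelian Varieties* (1970), §19 Cor. 2 of Thm. 1 (homomorphisms between simple varieties). [cite: MumfordAV1970, §19 Cor. 2 of Thm. 1 (p. 174)]
* [Ribet1983] K. A. Ribet, Amer. J. Math. 105 (1983), Thm. 3. [cite: Ribet1983, Thm. 3]
-/

noncomputable section

open scoped TensorProduct
open CategoryTheory CategoryTheory.Limits Module NumberField

namespace Summit.HodgeConjecture.CorCM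

open Literature.AlgebraicGeometry.Motives
open Literature.AlgebraicGeometry.Motives.AbelianVariety
open Literature.AlgebraicGeometry.Motives.HodgeStructure
open Literature.AlgebraicGeometry.HodgeTheory
open Literature.AlgebraicGeometry.ComplexMultiplication
open Literature.AlgebraicGeometry.Milne1999 (IsOfCMType)

variable [HodgeTensorFacts.{0, 0}] {X : AbelianVariety ℂ} {n : ℕ}

omit [HodgeTensorFacts.{0, 0}] in
/-- `Hom(A × A′, E) = 0` for `End⁰A`, `End⁰A′` fields (so `A`, `A′` simple) of dimensions `≥ 2` and an elliptic curve `E` (simple varieties of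
different dimensions have no non-zero homomorphisms; a map out of a product vanishes when it vanishes on both factors).
[cite: MumfordAV1970, §19 Cor. 2 of Thm. 1 (p. 174)] -/
theorem forall_prod_hom_curve_eq_zero {A A' E : AbelianVariety ℂ} (hF : IsField A.endAlgebra) (hF' : IsField A'.endAlgebra)
    (h2 : 2 ≤ A.dim) (h2' : 2 ≤ A'.dim) (hE1 : E.dim = 1) : ∀ u : A.prod A' ⟶ E, u = 0 :=
  prod_hom_eq_zero_of_forall
    (hom_eq_zero_of_isSimple_of_dim_ne (isSimple_of_isField_endAlgebra hF) (isSimple_of_dim_le_one hE1.le) (by omega))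
    (hom_eq_zero_of_isSimple_of_dim_ne (isSimple_of_isField_endAlgebra hF') (isSimple_of_dim_le_one hE1.le) (by omega))

/-- **`t(X) = t(A × A′) + 3` for `X ∼ (A × A′) × E`, `E` a non-CM elliptic curve**, `End⁰A`, `End⁰A′` fields, `dim A, dim A′ ≥ 2`
(`CorCM/MumfordTateRankTimesNonCMCurve`: Moonen–Zarhinʼs Lemma (3.4) for the curve, `Hom(A × A′, E) = 0`).
[cite: MoonenZarhin1999LowDim, §3 Lemma (3.4)] -/
theorem mtRank_hodge_one_eq_of_isIsogenous_prod_prod_nonCMCurve (hX : IsSmoothProjective n X.X) {A A' E : AbelianVariety ℂ} {m : ℕ}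
    (hP : IsSmoothProjective m (A.prod A').X) (hF : IsField A.endAlgebra) (hF' : IsField A'.endAlgebra) (h2 : 2 ≤ A.dim) (h2' : 2 ≤ A'.dim)
    (hE1 : E.dim = 1) (hEcm : ¬ IsOfCMType E) (hXP : IsIsogenous X ((A.prod A').prod E)) :
    haveI := BettiUniverse.finite hX 1
    haveI := BettiUniverse.finite hP 1
    (BettiUniverse.hodge exists_isReal_hodgeModel_holds hX 1).mtRank = (BettiUniverse.hodge exists_isReal_hodgeModel_holds hP 1).mtRank + 3 :=
  mtRank_hodge_one_eq_add_three_of_isIsogenous_prod_nonCMCurve hX hP (by rw [dim_prod]; omega) hE1 hEcm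
    (forall_prod_hom_curve_eq_zero hF hF' h2 h2' hE1) hXP

/-- **Trichotomy for `(A × A′) × E`**, `A`, `A′` of Ribet types `(g−1,1)`, `(g′−1,1)`, `E` a non-CM elliptic curve: `t = g² + 4` (`A ∼ A′`) /
`g² + g′² + 3` (`A ≁ A′`, isomorphic fields) / `g² + g′² + 4` (non-isomorphic fields). [cite: MoonenZarhin1999LowDim, §3 Lemma (3.4) and Prop. (3.8)]
[cite: Ribet1983, Thm. 3] -/
theorem mtRank_hodge_one_trichotomy_of_isIsogenous_ribetTypeOne_prod_prod_nonCMCurve (hX : IsSmoothProjective n X.X) {A A' E : AbelianVariety ℂ}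
    (hF : IsField A.endAlgebra) (hnR : ¬ IsTotallyReal (EndField A hF)) (φ : A ⟶ A) {d : ℕ} (hd : 0 < d) (hφ : φ ≫ φ = -(d • 𝟙 A))
    (hAE : Module.finrank ℚ A.endAlgebra = 2)
    (h1 : eigenMultiplicity A φ (Complex.I * (Real.sqrt d : ℂ)) = 1 ∨ eigenMultiplicity A φ (-(Complex.I * (Real.sqrt d : ℂ))) = 1) (hdim : 3 ≤ A.dim)
    (hF' : IsField A'.endAlgebra) (hnR' : ¬ IsTotallyReal (EndField A' hF')) (φ' : A' ⟶ A') {d' : ℕ} (hd' : 0 < d') (hφ' : φ' ≫ φ' = -(d' • 𝟙 A'))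
    (hA'E : Module.finrank ℚ A'.endAlgebra = 2)
    (h1' : eigenMultiplicity A' φ' (Complex.I * (Real.sqrt d' : ℂ)) = 1 ∨ eigenMultiplicity A' φ' (-(Complex.I * (Real.sqrt d' : ℂ))) = 1)
    (hdim' : 3 ≤ A'.dim) (hE1 : E.dim = 1) (hEcm : ¬ IsOfCMType E) (hXP : IsIsogenous X ((A.prod A').prod E)) :
    haveI := BettiUniverse.finite hX 1
    (IsIsogenous A A' ∧ (BettiUniverse.hodge exists_isReal_hodgeModel_holds hX 1).mtRank = A.dim * A.dim + 4) ∨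
      (¬ IsIsogenous A A' ∧ Nonempty (A'.endAlgebra →+* A.endAlgebra) ∧
        (BettiUniverse.hodge exists_isReal_hodgeModel_holds hX 1).mtRank = A.dim * A.dim + A'.dim * A'.dim + 3) ∨
      (IsEmpty (A'.endAlgebra →+* A.endAlgebra) ∧ (BettiUniverse.hodge exists_isReal_hodgeModel_holds hX 1).mtRank = A.dim * A.dim + A'.dim * A'.dim + 4) := by
  haveI := BettiUniverse.finite hX 1
  have hP : IsSmoothProjective (A.prod A').dim (A.prod A').X := AbelianVariety.isSmoothProjective_holds
  haveI := BettiUniverse.finite hP 1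
  have h3 := mtRank_hodge_one_eq_of_isIsogenous_prod_prod_nonCMCurve hX hP hF hF' (by omega) (by omega) hE1 hEcm hXP
  rcases mtRank_hodge_one_trichotomy_of_isIsogenous_prod_ribetTypeOne' hP hF hnR φ hd hφ hAE h1 hdim hF' hnR' φ' hd' hφ' hA'E h1' hdim' (IsIsogenous.refl _)
    with ⟨hi, ht⟩ | ⟨hni, hfor, ht⟩ | ⟨hfor, ht⟩
  · exact Or.inl ⟨hi, by rw [h3, ht]⟩
  · exact Or.inr (Or.inl ⟨hni, hfor, by rw [h3, ht]⟩)
  · exact Or.inr (Or.inr ⟨hfor, by rw [h3, ht]⟩)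

/-- **`H¹((A × A′) × E)` is `Θ`-rigid** for `A`, `A′` of Ribet types of DIFFERENT dimensions and a non-CM elliptic curve `E`
(`hodgeLie_rigid_prod_ribetTypeOne_of_dim_ne` and the inheritance of rigidity along a non-CM curve, `hodgeLie_rigid_prod_nonCMCurve_of_rigid`).
[cite: MoonenZarhin1999LowDim, §3 (3.1) and Lemma (3.4)] -/
theorem hodgeLie_rigid_ribetTypeOne_prod_prod_nonCMCurve_of_dim_ne {A A' E : AbelianVariety ℂ} {m l : ℕ} (hP : IsSmoothProjective m (A.prod A').X)
    (hQ : IsSmoothProjective l ((A.prod A').prod E).X)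
    (hF : IsField A.endAlgebra) (hnR : ¬ IsTotallyReal (EndField A hF)) (φ : A ⟶ A) {d : ℕ} (hd : 0 < d) (hφ : φ ≫ φ = -(d • 𝟙 A))
    (hAE : Module.finrank ℚ A.endAlgebra = 2)
    (h1 : eigenMultiplicity A φ (Complex.I * (Real.sqrt d : ℂ)) = 1 ∨ eigenMultiplicity A φ (-(Complex.I * (Real.sqrt d : ℂ))) = 1) (hdim : 3 ≤ A.dim)
    (hF' : IsField A'.endAlgebra) (hnR' : ¬ IsTotallyReal (EndField A' hF')) (φ' : A' ⟶ A') {d' : ℕ} (hd' : 0 < d') (hφ' : φ' ≫ φ' = -(d' • 𝟙 A'))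
    (hA'E : Module.finrank ℚ A'.endAlgebra = 2)
    (h1' : eigenMultiplicity A' φ' (Complex.I * (Real.sqrt d' : ℂ)) = 1 ∨ eigenMultiplicity A' φ' (-(Complex.I * (Real.sqrt d' : ℂ))) = 1)
    (hdim' : 3 ≤ A'.dim) (hne : A.dim ≠ A'.dim) (hE1 : E.dim = 1) (hEcm : ¬ IsOfCMType E) :
    haveI := BettiUniverse.finite hQ 1
    ∀ 𝔞 : Submodule ℚ (Module.End ℚ (bettiCohomology ((A.prod A').prod E).X 1)),
      𝔞 ≤ (BettiUniverse.hodge exists_isReal_hodgeModel_holds hQ 1).hodgeLie →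
      (∀ B ∈ 𝔞, ∀ B' ∈ 𝔞, B * B' - B' * B ∈ 𝔞) →
      (∃ Θ ∈ Submodule.span ℂ ((fun B : Module.End ℚ (bettiCohomology ((A.prod A').prod E).X 1) => B.baseChange ℂ) ''
          (𝔞 : Set (Module.End ℚ (bettiCohomology ((A.prod A').prod E).X 1)))),
        ∀ p, ∀ x ∈ (BettiUniverse.hodge exists_isReal_hodgeModel_holds hQ 1).piece p (((1 : ℕ) : ℤ) - p),
          Θ x = ((2 * p - ((1 : ℕ) : ℤ) : ℤ) : ℂ) • x) →
      (BettiUniverse.hodge exists_isReal_hodgeModel_holds hQ 1).hodgeLie ≤ 𝔞 :=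
  hodgeLie_rigid_prod_nonCMCurve_of_rigid hP hQ
    (hodgeLie_rigid_prod_ribetTypeOne_of_dim_ne hP hF hnR φ hd hφ hAE h1 hdim hF' hnR' φ' hd' hφ' hA'E h1' hdim' hne) hE1 hEcm
    (forall_prod_hom_curve_eq_zero hF hF' (by omega) (by omega) hE1)

/-- **`t(X) ≥ t(A × A′) + 3` for every `X ∼ ((A × A′) × E) × Y`**, `A`, `A′` of Ribet types of different dimensions, `E` a non-CM elliptic
curve (`mtRank_hodge_one_add_three_le_of_isIsogenous_prod_nonCMCurve_prod_of_rigid`). [cite: MoonenZarhin1999LowDim, §3 (3.1) and Lemma (3.4)] -/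
theorem mtRank_hodge_one_add_three_le_of_isIsogenous_ribetTypeOne_prod_prod_nonCMCurve_prod (hX : IsSmoothProjective n X.X)
    {A A' E Y : AbelianVariety ℂ} {m : ℕ} (hP : IsSmoothProjective m (A.prod A').X)
    (hF : IsField A.endAlgebra) (hnR : ¬ IsTotallyReal (EndField A hF)) (φ : A ⟶ A) {d : ℕ} (hd : 0 < d) (hφ : φ ≫ φ = -(d • 𝟙 A))
    (hAE : Module.finrank ℚ A.endAlgebra = 2)
    (h1 : eigenMultiplicity A φ (Complex.I * (Real.sqrt d : ℂ)) = 1 ∨ eigenMultiplicity A φ (-(Complex.I * (Real.sqrt d : ℂ))) = 1) (hdim : 3 ≤ A.dim)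
    (hF' : IsField A'.endAlgebra) (hnR' : ¬ IsTotallyReal (EndField A' hF')) (φ' : A' ⟶ A') {d' : ℕ} (hd' : 0 < d') (hφ' : φ' ≫ φ' = -(d' • 𝟙 A'))
    (hA'E : Module.finrank ℚ A'.endAlgebra = 2)
    (h1' : eigenMultiplicity A' φ' (Complex.I * (Real.sqrt d' : ℂ)) = 1 ∨ eigenMultiplicity A' φ' (-(Complex.I * (Real.sqrt d' : ℂ))) = 1)
    (hdim' : 3 ≤ A'.dim) (hne : A.dim ≠ A'.dim) (hE1 : E.dim = 1) (hEcm : ¬ IsOfCMType E) (hXP : IsIsogenous X (((A.prod A').prod E).prod Y)) :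
    haveI := BettiUniverse.finite hX 1
    haveI := BettiUniverse.finite hP 1
    (BettiUniverse.hodge exists_isReal_hodgeModel_holds hP 1).mtRank + 3 ≤ (BettiUniverse.hodge exists_isReal_hodgeModel_holds hX 1).mtRank :=
  mtRank_hodge_one_add_three_le_of_isIsogenous_prod_nonCMCurve_prod_of_rigid hX hP (by rw [dim_prod]; omega)
    (hodgeLie_rigid_prod_ribetTypeOne_of_dim_ne hP hF hnR φ hd hφ hAE h1 hdim hF' hnR' φ' hd' hφ' hA'E h1' hdim' hne) hE1 hEcm
    (forall_prod_hom_curve_eq_zero hF hF' (by omega) (by omega) hE1) hXP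

end Summit.HodgeConjecture.CorCM

end
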